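import Summits.QuantumFields.YangMills.Theorems.FluctuationComparisonRegPrIntLS2BetaStratumBodyOfGuardedLettersFloor
import Summits.QuantumFields.YangMills.Theorems.FluctuationComparisonRegPrIntLS2BetaGapOrbitOfStrataFloor
import HarnessLib

/-!
# S2β ∕ GAP♯∘ — «(ii)-AT-FLOOR»: THE FLOORED STUB TEXT GAP♯∘ (registry v12, planner RULING №120 «SEED HEIGHT FLOOR») AT THE GUARDED STRATA — FROM {the `L = 3` Thm-1 pair `h3`; per stratum
# (IRR, A′): a good-gauge SUPPLIER `hsuppᵢ` ABOVE A HEIGHT FLOOR (`∃ J₀` after `∀ F γ`) into a class `Gᵢ′` with bonds `≤ s₀ ≤ 1∕128`, the (D-stage) letter AT `Gᵢ′`, the split D′-budget ⁗ AT `Gᵢ′`}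
# — px5 g24's ✓`uniformFibreGapOrbit_of_strata_floor` ∘ w4 g28's ✓`gapStratum_of_guardedLetters_floor` (= ✓`gapStratum_of_goodGauge_floor` ∘ ✓p838119's G′-body), one term

Cell `ym3-torus` (YM ladder rung R3 = continuum `SU(2)` Yang–Mills on the three-torus — a RUNG: NOT d = 4, NOT infinite volume, NOT a mass gap, NOT Clay).  Width seat `ym-ust-20520-w5`
(gen 28), helper on crux `stmt-QuantumFields-20520`, LINE g18-1 S2β; `--kind proof --supports … --as helper`, DEFINITION-FREE; ONE decl-local `set_option maxHeartbeats 400000 in`.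
WHY (LEAD w3 g29 №30∕№32 (2) «a floored top (ii)-AT-FLOOR over (F1) is the natural successor of (B)»∕№33∕№37; planner RULING №120; desk RULING №119).  ✓p838199 `uniformFibreGapOrbit_of_guardedStrata`
(the floor-FREE (ii)-AT) is correct but its `hsuppᵢ` at the ruling's instances `Gᵢ ∧ G_{s₀}` are UNINHABITED as `∀ F ∀ J` letters (✓`not_hsupp_irrStratum`, ✓`not_hsupp_abelianStratum`:
near-flat tori at `(F.m, J) = (1, 0)` defeat every small-bond gauge).  The registry's v12 edition moves the free height floor of line v19.2 into GAP♯∘ (`… γ ≤ γ₁ → ∃ J₀ : ℕ, ∀ (J K : ℕ)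
(hJ₀ : J₀ ≤ J) (hJK : J ≤ K) …`), and px5 g24's floored door asks the supplier only above `J₀`.  THIS FILE is the floored composition: its `hsuppᵢ` = ✓`gapStratum_of_goodGauge_floor`'s `hsupp`
at `(G_IRR, G₁′)` ∕ `(G_A′, G₂′)` byte for byte (the invariant strata inlined as in ✓`uniformFibreGapOrbit_of_strata`); `hDᵢ`∕`hDBXᵢ`∕`hGsᵢ` = ✓p838199's byte for byte; conclusion = the v12
`UniformFibreGapOrbit` body with `argminHist`∕`ResidualGauge` unfolded (string-checked against LEAD's v12.1 SIGNATURE 723fe56f); proof = ONE TERM.  GAP LIST BY KERNEL on landing, for the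
FLOORED GAP♯∘: {h3 (EMBARGO-LITE №58); hsupp₁, hsupp₂ ABOVE THE FLOOR (OPEN — (BG∞) N-uniform small-bond «vortex-lattice» gauge `arc ≤ C(√θ_J + c∕N_J)`, NEW, or (LOC-G) print's local
re-lining; LEAD UV3-NODE §114, FL-39-LITE); hD at G₁′, G₂′ (D-GUARD); hDBX⁗ at G₁′, G₂′ (⟸ ✓p838137 (η)-2 at `G := Gᵢ′` ⟸ hPκ∕hPρ ⟸ the columns)} — no kernel-false hypothesis remains
on this road (desk №119 R1 gap list (v)).
HONEST SCOPE.  Composition BY NAME, zero mathematics of its own; the seven hypotheses are HYPOTHESES; nothing of Bałaban's analysis is asserted or proved ([Balaban1985Variational]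
Thm 1 (8)–(10) p.279, (4) p.278, (142) p.299; [Balaban1985Averaging] Prop. 3 (123) p.36, Prop. 4 (128)–(135) pp.37–38; [Balaban1985RegularSpaces] (1.29) p.81, Thm 2 p.83; [Balaban1985UV3]
(7) p.257); GAP♯∘ (`stub_uniformFibreGapOrbit`, v11 or v12 text), the five registered stubs (0∕5), S2β, crux 20520, 19936, 19200 and `YM3TorusSU2` are NOT proved; no registered stub is
closed; the registry is the planner's (no `Lines/` byte touched here); rung R3 — NOT d = 4, NOT infinite volume, NOT a mass gap, NOT Clay; the Yang–Mills mass gap is NOT proved.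
-/

set_option autoImplicit false

noncomputable section

open Set Function Finset
open scoped Matrix.Norms.L2Operator RealInnerProductSpace Real
open Literature.MathematicalPhysics.QuantumLattice (su2Quat)
open Literature.MathematicalPhysics.QuantumFieldTheory.Balaban1983to89
open Literature.MathematicalPhysics.QuantumFieldTheory.Balaban1983to89.T4Continuum
open Literature.MathematicalPhysics.QuantumFieldTheory.Balaban1983to89.T3ContinuumYM3Torus
open Literature.MathematicalPhysics.QuantumFieldTheory.Balaban1983to89.T3UnitScaleTilt
open Literature.MathematicalPhysics.QuantumFieldTheory.Balaban1983to89.T3TiltDescent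
open Literature.MathematicalPhysics.QuantumFieldTheory.Balaban1983to89.T3LevelShift
open Literature.MathematicalPhysics.QuantumFieldTheory.Balaban1983to89.T3DescentFibreTower
open Literature.MathematicalPhysics.QuantumFieldTheory.Balaban1983to89.T3PrintedRegularMinimiser
open Literature.MathematicalPhysics.QuantumFieldTheory.Balaban1983to89.T3PrintedRegularOrbits
open Literature.MathematicalPhysics.QuantumFieldTheory.Balaban1983to89.BlockAveraging
open Literature.MathematicalPhysics.QuantumFieldTheory.Balaban1983to89.ExpMeanLog (deltaSU)
open Literature.MathematicalPhysics.QuantumFieldTheory.Balaban1983to89.B10Eq27TorusAxialLog (unitsField toUField rel axialT)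
open Literature.MathematicalPhysics.QuantumFieldTheory.Balaban1983to89.B9AdOrthogonal (σ₃)
open Literature.MathematicalPhysics.QuantumFieldTheory.Balaban1983to89.T3UnitLawDensityEML (ℰp)
open Literature.MathematicalPhysics.QuantumFieldTheory.Balaban1983to89.T3ConstrainedMinimiser (fibre)
open Literature.MathematicalPhysics.QuantumFieldTheory.Balaban1983to89.T3PrintedMinimiserExistence (Thm1GlobalMinAt)
open Literature.MathematicalPhysics.QuantumFieldTheory.Balaban1983to89.T3Thm1UniquenessSchema (Thm1UniqueMinOrbitAt)
open Literature.MathematicalPhysics.QuantumFieldTheory.Balaban1983to89.T4CubeChartGnomonic (SU2)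
open Literature.MathematicalPhysics.QuantumFieldTheory.Balaban1983to89.T4HaarSU2ExpChart (expPoint)
open Literature.MathematicalPhysics.QuantumFieldTheory.Balaban1983to89.T4ExpWindowSmallField (imVec logVec)
open Summit.QuantumFields.YangMills.Theorems.FluctuationComparisonRegPrIntLS2BetaGapOrbitOfStrataFloor (uniformFibreGapOrbit_of_strata_floor)
open Summit.QuantumFields.YangMills.Theorems.FluctuationComparisonRegPrIntLS2BetaStratumBodyOfGuardedLettersFloor (gapStratum_of_guardedLetters_floor)

namespace Summit.QuantumFields.YangMills.Theorems.FluctuationComparisonRegPrIntLS2BetaGapOrbitOfGuardedStrataFloor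

set_option maxHeartbeats 400000 in
/-- ★★★ **THE FLOORED GAP♯∘ (registry v12 text VERBATIM, `argminHist`∕`ResidualGauge` unfolded) FROM {h3; (hsupp above the floor, hD, hDBX⁗) at a good-gauge class, per stratum}** —
«(ii)-AT-FLOOR»: ✓`uniformFibreGapOrbit_of_strata_floor` (px5 g24) ∘ ✓`gapStratum_of_guardedLetters_floor` (w4 g28) at `(G_IRR, G₁′)` and `(G_A′, G₂′)`, one term.
[cite: Balaban1985Variational, Thm 1 (8)-(10) p.279, (4) p.278, (142) p.299; Balaban1985Averaging, Prop. 3 (123) p.36, Prop. 4 (128)-(135) pp.37-38; Balaban1985RegularSpaces, (1.29) p.81, Thm 2 p.83; Balaban1985UV3, (7) p.257] -/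
theorem uniformFibreGapOrbit_of_guardedStrata_floor (G₁' G₂' : (F : T3Family) → (J : ℕ) → GaugeField (F.P J) 0 (Matrix.specialUnitaryGroup (Fin 2) ℂ) → Prop)
    (s₀ : ℝ) (hs₀ : s₀ ≤ 1 / 128)
    (hGs₁ : ∀ (F : T3Family) (J : ℕ) (V : GaugeField (F.P J) 0 (Matrix.specialUnitaryGroup (Fin 2) ℂ)),
      G₁' F J V → ∀ e, ‖logVec (su2Quat (V e))‖ ≤ s₀)
    (hGs₂ : ∀ (F : T3Family) (J : ℕ) (V : GaugeField (F.P J) 0 (Matrix.specialUnitaryGroup (Fin 2) ℂ)),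
      G₂' F J V → ∀ e, ‖logVec (su2Quat (V e))‖ ≤ s₀)
    (h3 : ∃ a₀ a₁ B₃ : ℝ, 0 < a₀ ∧ 0 < a₁ ∧ 0 < B₃ ∧ Thm1GlobalMinAt 3 a₀ a₁ B₃ ∧ Thm1UniqueMinOrbitAt 3 a₀ a₁ B₃)
    (hsupp₁ : ∀ (L : ℕ), ∃ c₀ : ℝ, 0 < c₀ ∧ c₀ ≤ 1 ∧ ∀ (cw : ℝ), 0 < cw → cw ≤ c₀ → ∃ pS : ℝ, ∀ (b₀ p₀ : ℝ), 0 < b₀ → pS ≤ p₀ → 0 < p₀ →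
      ∃ γ₁ : ℝ, 0 < γ₁ ∧ ∀ (F : T3Family) (γ : ℝ), F.L = L → 0 < γ → γ ≤ γ₁ → ∃ J₀ : ℕ,
        ∀ (J : ℕ) (hJ₀ : J₀ ≤ J) (V : GaugeField (F.P J) 0 (Matrix.specialUnitaryGroup (Fin 2) ℂ)), PlaqSmall (θBal F.L γ (cw * b₀) p₀ J) V → (∀ c : Site (F.P J) 0 → Matrix (Fin 2) (Fin 2) ℂ,
          (∀ e : PBond (F.P J) 0, c e.src = ((unitsField (toUField V) e : (Matrix (Fin 2) (Fin 2) ℂ)ˣ) : Matrix (Fin 2) (Fin 2) ℂ) * c e.tgt *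
            (((unitsField (toUField V) e)⁻¹ : (Matrix (Fin 2) (Fin 2) ℂ)ˣ) : Matrix (Fin 2) (Fin 2) ℂ)) →
          ∃ z : ℂ, ∀ y, c y = z • (1 : Matrix (Fin 2) (Fin 2) ℂ)) →
          ∃ u : GaugeTransf (F.P J) 0 (Matrix.specialUnitaryGroup (Fin 2) ℂ), G₁' F J (GaugeField.gaugeAct u V))
    (hD₁ : ∀ (L : ℕ), ∃ c₀ : ℝ, 0 < c₀ ∧ c₀ ≤ 1 ∧ ∀ (cw : ℝ), 0 < cw → cw ≤ c₀ → ∃ pS : ℝ, ∀ (b₀ p₀ : ℝ), 0 < b₀ → pS ≤ p₀ → 0 < p₀ → ∃ ε₁ : ℝ, 0 < ε₁ ∧ ∀ (ε₀ : ℝ), 0 < ε₀ → ε₀ ≤ ε₁ →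
    ∃ γ₁ : ℝ, 0 < γ₁ ∧ ∃ C_D : ℝ, 0 < C_D ∧ ∀ (F : T3Family) (γ : ℝ), F.L = L → 0 < γ → γ ≤ γ₁ →
      ∀ (J K : ℕ) (hJK : J ≤ K) (V : GaugeField (F.P J) 0 (Matrix.specialUnitaryGroup (Fin 2) ℂ)), PlaqSmall (θBal F.L γ (cw * b₀) p₀ J) V →
        G₁' F J V →
        ∀ U₀ ∈ {U' : GaugeField (F.P K) 0 (Matrix.specialUnitaryGroup (Fin 2) ℂ) | U' ∈ fibre F ℰp J K hJK V ∧ U' ∈ histGood F ℰp (θBal F.L γ b₀ p₀) K J ∧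
            wilsonAction4 U' = minActionRegPr F J K hJK ε₀ V},
        ∀ U ∈ fibre F ℰp J K hJK V, U ∈ histGood F ℰp (θBal F.L γ b₀ p₀) K J →
          (∃ (wt : (j : ℕ) → PBond (F.P K) j → PBond (F.P K) (j + 1) → ℝ)
            (lift : (j : ℕ) → GaugeField (F.P K) (j + 1) SU2 → GaugeField (F.P K) j SU2)
            (U₁ : GaugeField (F.P K) 0 SU2) (g g₀ : (j : ℕ) → Site (F.P K) j → SU2),
          (∀ j b e, wt j b e = if e.dir = b.dir ∧ (b.src b.dir - emb e.src b.dir).val < (F.P K).L then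
              ∏ ν ∈ Finset.univ.erase b.dir, max 0 (1 - ((rel (emb e.src) b.src ν).natAbs : ℝ) / (F.P K).L) else 0) ∧
          (∀ j X b, lift j X b = expPoint (∑ e, wt j b e • ((((F.P K).L : ℕ) : ℝ)⁻¹ • logVec (su2Quat (X e))))) ∧
          (∀ j, j < K - J → ∀ x, g j x =
            (axialT (lift j (GaugeField.gaugeAct (g (j + 1)) (Averaging.iter (fun k => blockAvg (P := F.P K) (j := k) ℰp) (j + 1) U)))
                (emb (blockOf x)) x)⁻¹ *
              g (j + 1) (blockOf x) * axialT (Averaging.iter (fun k => blockAvg (P := F.P K) (j := k) ℰp) j U) (emb (blockOf x)) x) ∧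
          (∀ j, K - J ≤ j → ∀ y, g j y = 1) ∧
          (∀ j, j < K - J → ∀ y : Site (F.P K) (j + 1), g j (emb y) = g (j + 1) y) ∧
          (∀ X : GaugeField (F.P K) 0 SU2, ∀ j, j ≤ K - J →
            Averaging.iter (fun k => blockAvg (P := F.P K) (j := k) ℰp) j (GaugeField.gaugeAct (g 0) X) =
              GaugeField.gaugeAct (g j) (Averaging.iter (fun k => blockAvg (P := F.P K) (j := k) ℰp) j X)) ∧
          (∀ j, j < K - J → ∀ x,
            axialT (GaugeField.gaugeAct (g j) (Averaging.iter (fun k => blockAvg (P := F.P K) (j := k) ℰp) j U)) (emb (blockOf x)) x =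
              axialT (lift j (GaugeField.gaugeAct (g (j + 1)) (Averaging.iter (fun k => blockAvg (P := F.P K) (j := k) ℰp) (j + 1) U)))
                (emb (blockOf x)) x) ∧
          (∀ j, j < K - J →
            (blockAvg (P := F.P K) (j := j) ℰp).avg (GaugeField.gaugeAct (g j) (Averaging.iter (fun k => blockAvg (P := F.P K) (j := k) ℰp) j U)) =
              GaugeField.gaugeAct (g (j + 1)) (Averaging.iter (fun k => blockAvg (P := F.P K) (j := k) ℰp) (j + 1) U)) ∧
          (∀ j, j < K - J → ∀ x, g₀ j x =
            (axialT (lift j (GaugeField.gaugeAct (g₀ (j + 1)) (Averaging.iter (fun k => blockAvg (P := F.P K) (j := k) ℰp) (j + 1) U₁)))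
                (emb (blockOf x)) x)⁻¹ *
              g₀ (j + 1) (blockOf x) * axialT (Averaging.iter (fun k => blockAvg (P := F.P K) (j := k) ℰp) j U₁) (emb (blockOf x)) x) ∧
          (∀ j, K - J ≤ j → ∀ y, g₀ j y = 1) ∧
          (∀ j, j < K - J → ∀ y : Site (F.P K) (j + 1), g₀ j (emb y) = g₀ (j + 1) y) ∧
          (∀ X : GaugeField (F.P K) 0 SU2, ∀ j, j ≤ K - J →
            Averaging.iter (fun k => blockAvg (P := F.P K) (j := k) ℰp) j (GaugeField.gaugeAct (g₀ 0) X) =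
              GaugeField.gaugeAct (g₀ j) (Averaging.iter (fun k => blockAvg (P := F.P K) (j := k) ℰp) j X)) ∧
          (∀ j, j < K - J → ∀ x,
            axialT (GaugeField.gaugeAct (g₀ j) (Averaging.iter (fun k => blockAvg (P := F.P K) (j := k) ℰp) j U₁)) (emb (blockOf x)) x =
              axialT (lift j (GaugeField.gaugeAct (g₀ (j + 1)) (Averaging.iter (fun k => blockAvg (P := F.P K) (j := k) ℰp) (j + 1) U₁)))
                (emb (blockOf x)) x) ∧
          (∀ j, j < K - J →
            (blockAvg (P := F.P K) (j := j) ℰp).avg (GaugeField.gaugeAct (g₀ j) (Averaging.iter (fun k => blockAvg (P := F.P K) (j := k) ℰp) j U₁)) =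
              GaugeField.gaugeAct (g₀ (j + 1)) (Averaging.iter (fun k => blockAvg (P := F.P K) (j := k) ℰp) (j + 1) U₁)) ∧
          (∀ X : GaugeField (F.P K) 0 SU2, Averaging.iter (fun k => blockAvg (P := F.P K) (j := k) ℰp) (K - J) (GaugeField.gaugeAct (fun x => (g 0 x)⁻¹) X) = Averaging.iter (fun k => blockAvg (P := F.P K) (j := k) ℰp) (K - J) X) ∧
          (∀ X : GaugeField (F.P K) 0 SU2, Averaging.iter (fun k => blockAvg (P := F.P K) (j := k) ℰp) (K - J) (GaugeField.gaugeAct (g₀ 0) X) = Averaging.iter (fun k => blockAvg (P := F.P K) (j := k) ℰp) (K - J) X) ∧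
          U₀ = GaugeField.gaugeAct (fun x => (g 0 x)⁻¹ * g₀ 0 x) U₁) →
          ((F.L : ℝ)⁻¹) ^ (2 * (K - J)) * ∑ ℓ : PBond (F.P K) 0, dist1 (U ℓ * (U₀ ℓ)⁻¹) ^ 2
            ≤ C_D * ∑ p : Plaq (F.P K) 0, (1 - reTr ((GaugeField.plaqHol U₀ p)⁻¹ * GaugeField.plaqHol U p)))
    (hDBX₁ :
      ∀ (L : ℕ), 1 < L → ∀ (C_B : ℝ), 0 ≤ C_B → ∃ α₀ : ℝ, 0 < α₀ ∧ ∃ q : ℝ, 0 ≤ q ∧ ∃ β_X : ℝ, 0 ≤ β_X ∧ (1 + (1 / 5 : ℝ)⁻¹) * (q + β_X) ≤ 1 / 4 ∧ ∃ C_X : ℝ, 0 ≤ C_X ∧ ∃ c_X : ℝ, 0 ≤ c_X ∧ ∀ (F : T3Family), F.L = L →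
      ∀ (J K : ℕ) (hJK : J ≤ K) (θ : ℕ → ℝ), (∀ i, 0 ≤ θ i) → ∀ (α : ℝ), (∀ i, J < i → i ≤ K → (((5 * F.L : ℕ) : ℝ) ^ 2 / 4) * θ i ≤ α) →
        (∑ i ∈ Finset.range (K - J), (((5 * F.L : ℕ) : ℝ) ^ 2 / 4) * θ (K - i)) ≤ α →
        α ≤ 1 / 24 → α < deltaSU (Fin 2) → 157 * α < ((F.L : ℝ) ^ 2)⁻¹ → α ≤ α₀ →
        ∀ U₀ : GaugeField (F.P K) 0 (Matrix.specialUnitaryGroup (Fin 2) ℂ), U₀ ∈ histGood F ℰp θ K J →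
        G₁' F J (descendTo F ℰp J K hJK U₀) →
        (∀ t, t ≤ K - J → ∀ p : Plaq (F.P K) t,
          dist1 (GaugeField.plaqHol (Averaging.iter (fun k => BlockAveraging.blockAvg (P := F.P K) (j := k) ℰp) t U₀) p) ≤
            C_B * α * (F.L : ℝ) ^ (2 * t) * ((F.L : ℝ)⁻¹) ^ (2 * (K - J))) →
        ∀ ζ : PBond (F.P K) 0 → EuclideanSpace ℝ (Fin 3), (∀ ℓ, ‖ζ ℓ‖ ≤ Real.pi) →
          (fun ℓ => expPoint (ζ ℓ) * U₀ ℓ : GaugeField (F.P K) 0 (Matrix.specialUnitaryGroup (Fin 2) ℂ)) ∈ histGood F ℰp θ K J →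
            descendTo F ℰp J K hJK (fun ℓ => expPoint (ζ ℓ) * U₀ ℓ : GaugeField (F.P K) 0 (Matrix.specialUnitaryGroup (Fin 2) ℂ)) = descendTo F ℰp J K hJK U₀ →
            ∀ (wt : (j : ℕ) → PBond (F.P K) j → PBond (F.P K) (j + 1) → ℝ)
            (lift : (j : ℕ) → GaugeField (F.P K) (j + 1) SU2 → GaugeField (F.P K) j SU2)
            (U₁ : GaugeField (F.P K) 0 SU2) (g g₀ : (j : ℕ) → Site (F.P K) j → SU2),
          (∀ j b e, wt j b e = if e.dir = b.dir ∧ (b.src b.dir - emb e.src b.dir).val < (F.P K).L then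
              ∏ ν ∈ Finset.univ.erase b.dir, max 0 (1 - ((rel (emb e.src) b.src ν).natAbs : ℝ) / (F.P K).L) else 0) →
          (∀ j X b, lift j X b = expPoint (∑ e, wt j b e • ((((F.P K).L : ℕ) : ℝ)⁻¹ • logVec (su2Quat (X e))))) →
          (∀ j, j < K - J → ∀ x, g j x =
            (axialT (lift j (GaugeField.gaugeAct (g (j + 1)) (Averaging.iter (fun k => blockAvg (P := F.P K) (j := k) ℰp) (j + 1) (fun ℓ => expPoint (ζ ℓ) * U₀ ℓ))))
                (emb (blockOf x)) x)⁻¹ *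
              g (j + 1) (blockOf x) * axialT (Averaging.iter (fun k => blockAvg (P := F.P K) (j := k) ℰp) j (fun ℓ => expPoint (ζ ℓ) * U₀ ℓ)) (emb (blockOf x)) x) →
          (∀ j, K - J ≤ j → ∀ y, g j y = 1) →
          (∀ j, j < K - J → ∀ y : Site (F.P K) (j + 1), g j (emb y) = g (j + 1) y) →
          (∀ X : GaugeField (F.P K) 0 SU2, ∀ j, j ≤ K - J →
            Averaging.iter (fun k => blockAvg (P := F.P K) (j := k) ℰp) j (GaugeField.gaugeAct (g 0) X) =
              GaugeField.gaugeAct (g j) (Averaging.iter (fun k => blockAvg (P := F.P K) (j := k) ℰp) j X)) →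
          (∀ j, j < K - J → ∀ x,
            axialT (GaugeField.gaugeAct (g j) (Averaging.iter (fun k => blockAvg (P := F.P K) (j := k) ℰp) j (fun ℓ => expPoint (ζ ℓ) * U₀ ℓ))) (emb (blockOf x)) x =
              axialT (lift j (GaugeField.gaugeAct (g (j + 1)) (Averaging.iter (fun k => blockAvg (P := F.P K) (j := k) ℰp) (j + 1) (fun ℓ => expPoint (ζ ℓ) * U₀ ℓ))))
                (emb (blockOf x)) x) →
          (∀ j, j < K - J →
            (blockAvg (P := F.P K) (j := j) ℰp).avg (GaugeField.gaugeAct (g j) (Averaging.iter (fun k => blockAvg (P := F.P K) (j := k) ℰp) j (fun ℓ => expPoint (ζ ℓ) * U₀ ℓ))) =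
              GaugeField.gaugeAct (g (j + 1)) (Averaging.iter (fun k => blockAvg (P := F.P K) (j := k) ℰp) (j + 1) (fun ℓ => expPoint (ζ ℓ) * U₀ ℓ))) →
          (∀ j, j < K - J → ∀ x, g₀ j x =
            (axialT (lift j (GaugeField.gaugeAct (g₀ (j + 1)) (Averaging.iter (fun k => blockAvg (P := F.P K) (j := k) ℰp) (j + 1) U₁)))
                (emb (blockOf x)) x)⁻¹ *
              g₀ (j + 1) (blockOf x) * axialT (Averaging.iter (fun k => blockAvg (P := F.P K) (j := k) ℰp) j U₁) (emb (blockOf x)) x) →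
          (∀ j, K - J ≤ j → ∀ y, g₀ j y = 1) →
          (∀ j, j < K - J → ∀ y : Site (F.P K) (j + 1), g₀ j (emb y) = g₀ (j + 1) y) →
          (∀ X : GaugeField (F.P K) 0 SU2, ∀ j, j ≤ K - J →
            Averaging.iter (fun k => blockAvg (P := F.P K) (j := k) ℰp) j (GaugeField.gaugeAct (g₀ 0) X) =
              GaugeField.gaugeAct (g₀ j) (Averaging.iter (fun k => blockAvg (P := F.P K) (j := k) ℰp) j X)) →
          (∀ j, j < K - J → ∀ x,
            axialT (GaugeField.gaugeAct (g₀ j) (Averaging.iter (fun k => blockAvg (P := F.P K) (j := k) ℰp) j U₁)) (emb (blockOf x)) x =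
              axialT (lift j (GaugeField.gaugeAct (g₀ (j + 1)) (Averaging.iter (fun k => blockAvg (P := F.P K) (j := k) ℰp) (j + 1) U₁)))
                (emb (blockOf x)) x) →
          (∀ j, j < K - J →
            (blockAvg (P := F.P K) (j := j) ℰp).avg (GaugeField.gaugeAct (g₀ j) (Averaging.iter (fun k => blockAvg (P := F.P K) (j := k) ℰp) j U₁)) =
              GaugeField.gaugeAct (g₀ (j + 1)) (Averaging.iter (fun k => blockAvg (P := F.P K) (j := k) ℰp) (j + 1) U₁)) →
          (∀ X : GaugeField (F.P K) 0 SU2, Averaging.iter (fun k => blockAvg (P := F.P K) (j := k) ℰp) (K - J) (GaugeField.gaugeAct (fun x => (g 0 x)⁻¹) X) = Averaging.iter (fun k => blockAvg (P := F.P K) (j := k) ℰp) (K - J) X) →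
          (∀ X : GaugeField (F.P K) 0 SU2, Averaging.iter (fun k => blockAvg (P := F.P K) (j := k) ℰp) (K - J) (GaugeField.gaugeAct (g₀ 0) X) = Averaging.iter (fun k => blockAvg (P := F.P K) (j := k) ℰp) (K - J) X) →
          U₀ = GaugeField.gaugeAct (fun x => (g 0 x)⁻¹ * g₀ 0 x) U₁ →

                      ∃ X : ℕ → ℝ,
            (∀ (t : ℕ) (ht : t < K - J), (fun (u : ℕ) (hu : u < K - J) => ∑ B : PBond (F.P J) 0,
            ‖(fun ℓ' : PBond (F.P (J + (u + 1))) 0 =>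
              if (∃ z : Site (F.P (J + (u + 1))) 0,
                (B14.Eq22Determines.blockIter (u + 1) z = (bondShift (F.sitesPerDir_eq (m := F.m) (K := J) (j := 0) (m' := F.m) (K' := J + (u + 1)) (j' := u + 1) (by omega)) B).src ∨ B14.Eq22Determines.blockIter (u + 1) z = (bondShift (F.sitesPerDir_eq (m := F.m) (K := J) (j := 0) (m' := F.m) (K' := J + (u + 1)) (j' := u + 1) (by omega)) B).tgt) ∧
                ∀ ν, (B10Eq27TorusAxialLog.rel z ℓ'.src ν).natAbs ≤ 2) ∧
                ¬ (blockOf (ℓ'.src.shift ℓ'.dir) = blockOf ℓ'.src ∧ ∀ ν, ν < ℓ'.dir → B10Eq27TorusAxialLog.rel (emb (blockOf ℓ'.src)) ℓ'.src ν = 0)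
              then logVec (su2Quat ((lift (K - (J + (u + 1))) (GaugeField.gaugeAct (g ((K - (J + (u + 1))) + 1)) (Averaging.iter (fun k => blockAvg (P := F.P K) (j := k) ℰp) ((K - (J + (u + 1))) + 1) (fun ℓ => expPoint (ζ ℓ) * U₀ ℓ))) (bondShift (F.sitesPerDir_eq (m := F.m) (K := J + (u + 1)) (j := 0) (m' := F.m) (K' := K) (j' := (K - (J + (u + 1)))) (by omega)) ℓ') *
                    (lift (K - (J + (u + 1))) (GaugeField.gaugeAct (g₀ ((K - (J + (u + 1))) + 1)) (Averaging.iter (fun k => blockAvg (P := F.P K) (j := k) ℰp) ((K - (J + (u + 1))) + 1) U₁)) (bondShift (F.sitesPerDir_eq (m := F.m) (K := J + (u + 1)) (j := 0) (m' := F.m) (K' := K) (j' := (K - (J + (u + 1)))) (by omega)) ℓ'))⁻¹)⁻¹ *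
                  (GaugeField.gaugeAct (g (K - (J + (u + 1)))) (Averaging.iter (fun k => blockAvg (P := F.P K) (j := k) ℰp) (K - (J + (u + 1))) (fun ℓ => expPoint (ζ ℓ) * U₀ ℓ)) (bondShift (F.sitesPerDir_eq (m := F.m) (K := J + (u + 1)) (j := 0) (m' := F.m) (K' := K) (j' := (K - (J + (u + 1)))) (by omega)) ℓ') *
                    (GaugeField.gaugeAct (g₀ (K - (J + (u + 1)))) (Averaging.iter (fun k => blockAvg (P := F.P K) (j := k) ℰp) (K - (J + (u + 1))) U₁) (bondShift (F.sitesPerDir_eq (m := F.m) (K := J + (u + 1)) (j := 0) (m' := F.m) (K' := K) (j' := (K - (J + (u + 1)))) (by omega)) ℓ'))⁻¹))) else 0)‖ ^ 2) t ht ≤ X t + q * (fun (t : ℕ) (ht : t < K - J) => ∑ B : PBond (F.P J) 0,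
            ‖(fun ℓ' : PBond (F.P (J + (t + 1))) 0 =>
              if ∃ z : Site (F.P (J + (t + 1))) 0,
                (B14.Eq22Determines.blockIter (t + 1) z = (bondShift (F.sitesPerDir_eq (m := F.m) (K := J) (j := 0) (m' := F.m) (K' := J + (t + 1)) (j' := t + 1) (by omega)) B).src ∨ B14.Eq22Determines.blockIter (t + 1) z = (bondShift (F.sitesPerDir_eq (m := F.m) (K := J) (j := 0) (m' := F.m) (K' := J + (t + 1)) (j' := t + 1) (by omega)) B).tgt) ∧
                ∀ ν, (B10Eq27TorusAxialLog.rel z ℓ'.src ν).natAbs ≤ 2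
              then logVec (su2Quat (descendTo F ℰp (J + (t + 1)) K (by omega) (fun ℓ => expPoint (ζ ℓ) * U₀ ℓ : GaugeField (F.P K) 0 (Matrix.specialUnitaryGroup (Fin 2) ℂ)) ℓ' * (descendTo F ℰp (J + (t + 1)) K (by omega) U₀ ℓ')⁻¹)) else 0)‖ ^ 2) t ht) ∧
            ∑ t ∈ Finset.range (K - J), (F.L : ℝ) ^ t * X t ≤ C_X * Real.exp (c_X * ∑ i ∈ Finset.range (K - J), (((5 * F.L : ℕ) : ℝ) ^ 2 / 4) * θ (K - i)) * (((F.L : ℝ)⁻¹) ^ (K - J) * ∑ ℓ : PBond (F.P K) 0, ‖ζ ℓ‖ ^ 2 +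
                (F.L : ℝ) ^ (K - J) * ∑ p : Plaq (F.P K) 0,
                  (1 - reTr ((GaugeField.plaqHol U₀ p)⁻¹ * GaugeField.plaqHol (fun ℓ => expPoint (ζ ℓ) * U₀ ℓ : GaugeField (F.P K) 0 (Matrix.specialUnitaryGroup (Fin 2) ℂ)) p))) +
              β_X * (∑ t ∈ Finset.range (K - J), (if ht : t < K - J then
          (F.L : ℝ) ^ t * ∑ B : PBond (F.P J) 0,
            ‖(fun ℓ' : PBond (F.P (J + (t + 1))) 0 =>
              if ∃ z : Site (F.P (J + (t + 1))) 0,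
                (B14.Eq22Determines.blockIter (t + 1) z = (bondShift (F.sitesPerDir_eq (m := F.m) (K := J) (j := 0) (m' := F.m) (K' := J + (t + 1)) (j' := t + 1) (by omega)) B).src ∨ B14.Eq22Determines.blockIter (t + 1) z = (bondShift (F.sitesPerDir_eq (m := F.m) (K := J) (j := 0) (m' := F.m) (K' := J + (t + 1)) (j' := t + 1) (by omega)) B).tgt) ∧
                ∀ ν, (B10Eq27TorusAxialLog.rel z ℓ'.src ν).natAbs ≤ 2
              then logVec (su2Quat (descendTo F ℰp (J + (t + 1)) K (by omega) (fun ℓ => expPoint (ζ ℓ) * U₀ ℓ : GaugeField (F.P K) 0 (Matrix.specialUnitaryGroup (Fin 2) ℂ)) ℓ' * (descendTo F ℰp (J + (t + 1)) K (by omega) U₀ ℓ')⁻¹)) else 0)‖ ^ 2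
        else 0)))
    (hsupp₂ : ∀ (L : ℕ), ∃ c₀ : ℝ, 0 < c₀ ∧ c₀ ≤ 1 ∧ ∀ (cw : ℝ), 0 < cw → cw ≤ c₀ → ∃ pS : ℝ, ∀ (b₀ p₀ : ℝ), 0 < b₀ → pS ≤ p₀ → 0 < p₀ →
      ∃ γ₁ : ℝ, 0 < γ₁ ∧ ∀ (F : T3Family) (γ : ℝ), F.L = L → 0 < γ → γ ≤ γ₁ → ∃ J₀ : ℕ,
        ∀ (J : ℕ) (hJ₀ : J₀ ≤ J) (V : GaugeField (F.P J) 0 (Matrix.specialUnitaryGroup (Fin 2) ℂ)), PlaqSmall (θBal F.L γ (cw * b₀) p₀ J) V → (∃ g : GaugeTransf (F.P J) 0 (Matrix.specialUnitaryGroup (Fin 2) ℂ),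
          (∀ e : PBond (F.P J) 0, Commute (((GaugeField.gaugeAct g V) e : Matrix.specialUnitaryGroup (Fin 2) ℂ) : Matrix (Fin 2) (Fin 2) ℂ) σ₃) ∧
          ∀ c : Site (F.P J) 0 → Matrix (Fin 2) (Fin 2) ℂ,
            (∀ e : PBond (F.P J) 0, c e.src = ((unitsField (toUField (GaugeField.gaugeAct g V)) e : (Matrix (Fin 2) (Fin 2) ℂ)ˣ) : Matrix (Fin 2) (Fin 2) ℂ) * c e.tgt *
            (((unitsField (toUField (GaugeField.gaugeAct g V)) e)⁻¹ : (Matrix (Fin 2) (Fin 2) ℂ)ˣ) : Matrix (Fin 2) (Fin 2) ℂ)) →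
            ∃ c₀ : Matrix (Fin 2) (Fin 2) ℂ, (∀ y, c y = c₀) ∧ Commute c₀ σ₃) →
          ∃ u : GaugeTransf (F.P J) 0 (Matrix.specialUnitaryGroup (Fin 2) ℂ), G₂' F J (GaugeField.gaugeAct u V))
    (hD₂ : ∀ (L : ℕ), ∃ c₀ : ℝ, 0 < c₀ ∧ c₀ ≤ 1 ∧ ∀ (cw : ℝ), 0 < cw → cw ≤ c₀ → ∃ pS : ℝ, ∀ (b₀ p₀ : ℝ), 0 < b₀ → pS ≤ p₀ → 0 < p₀ → ∃ ε₁ : ℝ, 0 < ε₁ ∧ ∀ (ε₀ : ℝ), 0 < ε₀ → ε₀ ≤ ε₁ →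
    ∃ γ₁ : ℝ, 0 < γ₁ ∧ ∃ C_D : ℝ, 0 < C_D ∧ ∀ (F : T3Family) (γ : ℝ), F.L = L → 0 < γ → γ ≤ γ₁ →
      ∀ (J K : ℕ) (hJK : J ≤ K) (V : GaugeField (F.P J) 0 (Matrix.specialUnitaryGroup (Fin 2) ℂ)), PlaqSmall (θBal F.L γ (cw * b₀) p₀ J) V →
        G₂' F J V →
        ∀ U₀ ∈ {U' : GaugeField (F.P K) 0 (Matrix.specialUnitaryGroup (Fin 2) ℂ) | U' ∈ fibre F ℰp J K hJK V ∧ U' ∈ histGood F ℰp (θBal F.L γ b₀ p₀) K J ∧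
            wilsonAction4 U' = minActionRegPr F J K hJK ε₀ V},
        ∀ U ∈ fibre F ℰp J K hJK V, U ∈ histGood F ℰp (θBal F.L γ b₀ p₀) K J →
          (∃ (wt : (j : ℕ) → PBond (F.P K) j → PBond (F.P K) (j + 1) → ℝ)
            (lift : (j : ℕ) → GaugeField (F.P K) (j + 1) SU2 → GaugeField (F.P K) j SU2)
            (U₁ : GaugeField (F.P K) 0 SU2) (g g₀ : (j : ℕ) → Site (F.P K) j → SU2),
          (∀ j b e, wt j b e = if e.dir = b.dir ∧ (b.src b.dir - emb e.src b.dir).val < (F.P K).L then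
              ∏ ν ∈ Finset.univ.erase b.dir, max 0 (1 - ((rel (emb e.src) b.src ν).natAbs : ℝ) / (F.P K).L) else 0) ∧
          (∀ j X b, lift j X b = expPoint (∑ e, wt j b e • ((((F.P K).L : ℕ) : ℝ)⁻¹ • logVec (su2Quat (X e))))) ∧
          (∀ j, j < K - J → ∀ x, g j x =
            (axialT (lift j (GaugeField.gaugeAct (g (j + 1)) (Averaging.iter (fun k => blockAvg (P := F.P K) (j := k) ℰp) (j + 1) U)))
                (emb (blockOf x)) x)⁻¹ *
              g (j + 1) (blockOf x) * axialT (Averaging.iter (fun k => blockAvg (P := F.P K) (j := k) ℰp) j U) (emb (blockOf x)) x) ∧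
          (∀ j, K - J ≤ j → ∀ y, g j y = 1) ∧
          (∀ j, j < K - J → ∀ y : Site (F.P K) (j + 1), g j (emb y) = g (j + 1) y) ∧
          (∀ X : GaugeField (F.P K) 0 SU2, ∀ j, j ≤ K - J →
            Averaging.iter (fun k => blockAvg (P := F.P K) (j := k) ℰp) j (GaugeField.gaugeAct (g 0) X) =
              GaugeField.gaugeAct (g j) (Averaging.iter (fun k => blockAvg (P := F.P K) (j := k) ℰp) j X)) ∧
          (∀ j, j < K - J → ∀ x,
            axialT (GaugeField.gaugeAct (g j) (Averaging.iter (fun k => blockAvg (P := F.P K) (j := k) ℰp) j U)) (emb (blockOf x)) x =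
              axialT (lift j (GaugeField.gaugeAct (g (j + 1)) (Averaging.iter (fun k => blockAvg (P := F.P K) (j := k) ℰp) (j + 1) U)))
                (emb (blockOf x)) x) ∧
          (∀ j, j < K - J →
            (blockAvg (P := F.P K) (j := j) ℰp).avg (GaugeField.gaugeAct (g j) (Averaging.iter (fun k => blockAvg (P := F.P K) (j := k) ℰp) j U)) =
              GaugeField.gaugeAct (g (j + 1)) (Averaging.iter (fun k => blockAvg (P := F.P K) (j := k) ℰp) (j + 1) U)) ∧
          (∀ j, j < K - J → ∀ x, g₀ j x =
            (axialT (lift j (GaugeField.gaugeAct (g₀ (j + 1)) (Averaging.iter (fun k => blockAvg (P := F.P K) (j := k) ℰp) (j + 1) U₁)))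
                (emb (blockOf x)) x)⁻¹ *
              g₀ (j + 1) (blockOf x) * axialT (Averaging.iter (fun k => blockAvg (P := F.P K) (j := k) ℰp) j U₁) (emb (blockOf x)) x) ∧
          (∀ j, K - J ≤ j → ∀ y, g₀ j y = 1) ∧
          (∀ j, j < K - J → ∀ y : Site (F.P K) (j + 1), g₀ j (emb y) = g₀ (j + 1) y) ∧
          (∀ X : GaugeField (F.P K) 0 SU2, ∀ j, j ≤ K - J →
            Averaging.iter (fun k => blockAvg (P := F.P K) (j := k) ℰp) j (GaugeField.gaugeAct (g₀ 0) X) =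
              GaugeField.gaugeAct (g₀ j) (Averaging.iter (fun k => blockAvg (P := F.P K) (j := k) ℰp) j X)) ∧
          (∀ j, j < K - J → ∀ x,
            axialT (GaugeField.gaugeAct (g₀ j) (Averaging.iter (fun k => blockAvg (P := F.P K) (j := k) ℰp) j U₁)) (emb (blockOf x)) x =
              axialT (lift j (GaugeField.gaugeAct (g₀ (j + 1)) (Averaging.iter (fun k => blockAvg (P := F.P K) (j := k) ℰp) (j + 1) U₁)))
                (emb (blockOf x)) x) ∧
          (∀ j, j < K - J →
            (blockAvg (P := F.P K) (j := j) ℰp).avg (GaugeField.gaugeAct (g₀ j) (Averaging.iter (fun k => blockAvg (P := F.P K) (j := k) ℰp) j U₁)) =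
              GaugeField.gaugeAct (g₀ (j + 1)) (Averaging.iter (fun k => blockAvg (P := F.P K) (j := k) ℰp) (j + 1) U₁)) ∧
          (∀ X : GaugeField (F.P K) 0 SU2, Averaging.iter (fun k => blockAvg (P := F.P K) (j := k) ℰp) (K - J) (GaugeField.gaugeAct (fun x => (g 0 x)⁻¹) X) = Averaging.iter (fun k => blockAvg (P := F.P K) (j := k) ℰp) (K - J) X) ∧
          (∀ X : GaugeField (F.P K) 0 SU2, Averaging.iter (fun k => blockAvg (P := F.P K) (j := k) ℰp) (K - J) (GaugeField.gaugeAct (g₀ 0) X) = Averaging.iter (fun k => blockAvg (P := F.P K) (j := k) ℰp) (K - J) X) ∧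
          U₀ = GaugeField.gaugeAct (fun x => (g 0 x)⁻¹ * g₀ 0 x) U₁) →
          ((F.L : ℝ)⁻¹) ^ (2 * (K - J)) * ∑ ℓ : PBond (F.P K) 0, dist1 (U ℓ * (U₀ ℓ)⁻¹) ^ 2
            ≤ C_D * ∑ p : Plaq (F.P K) 0, (1 - reTr ((GaugeField.plaqHol U₀ p)⁻¹ * GaugeField.plaqHol U p)))
    (hDBX₂ :
      ∀ (L : ℕ), 1 < L → ∀ (C_B : ℝ), 0 ≤ C_B → ∃ α₀ : ℝ, 0 < α₀ ∧ ∃ q : ℝ, 0 ≤ q ∧ ∃ β_X : ℝ, 0 ≤ β_X ∧ (1 + (1 / 5 : ℝ)⁻¹) * (q + β_X) ≤ 1 / 4 ∧ ∃ C_X : ℝ, 0 ≤ C_X ∧ ∃ c_X : ℝ, 0 ≤ c_X ∧ ∀ (F : T3Family), F.L = L →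
      ∀ (J K : ℕ) (hJK : J ≤ K) (θ : ℕ → ℝ), (∀ i, 0 ≤ θ i) → ∀ (α : ℝ), (∀ i, J < i → i ≤ K → (((5 * F.L : ℕ) : ℝ) ^ 2 / 4) * θ i ≤ α) →
        (∑ i ∈ Finset.range (K - J), (((5 * F.L : ℕ) : ℝ) ^ 2 / 4) * θ (K - i)) ≤ α →
        α ≤ 1 / 24 → α < deltaSU (Fin 2) → 157 * α < ((F.L : ℝ) ^ 2)⁻¹ → α ≤ α₀ →
        ∀ U₀ : GaugeField (F.P K) 0 (Matrix.specialUnitaryGroup (Fin 2) ℂ), U₀ ∈ histGood F ℰp θ K J →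
        G₂' F J (descendTo F ℰp J K hJK U₀) →
        (∀ t, t ≤ K - J → ∀ p : Plaq (F.P K) t,
          dist1 (GaugeField.plaqHol (Averaging.iter (fun k => BlockAveraging.blockAvg (P := F.P K) (j := k) ℰp) t U₀) p) ≤
            C_B * α * (F.L : ℝ) ^ (2 * t) * ((F.L : ℝ)⁻¹) ^ (2 * (K - J))) →
        ∀ ζ : PBond (F.P K) 0 → EuclideanSpace ℝ (Fin 3), (∀ ℓ, ‖ζ ℓ‖ ≤ Real.pi) →
          (fun ℓ => expPoint (ζ ℓ) * U₀ ℓ : GaugeField (F.P K) 0 (Matrix.specialUnitaryGroup (Fin 2) ℂ)) ∈ histGood F ℰp θ K J →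
            descendTo F ℰp J K hJK (fun ℓ => expPoint (ζ ℓ) * U₀ ℓ : GaugeField (F.P K) 0 (Matrix.specialUnitaryGroup (Fin 2) ℂ)) = descendTo F ℰp J K hJK U₀ →
            ∀ (wt : (j : ℕ) → PBond (F.P K) j → PBond (F.P K) (j + 1) → ℝ)
            (lift : (j : ℕ) → GaugeField (F.P K) (j + 1) SU2 → GaugeField (F.P K) j SU2)
            (U₁ : GaugeField (F.P K) 0 SU2) (g g₀ : (j : ℕ) → Site (F.P K) j → SU2),
          (∀ j b e, wt j b e = if e.dir = b.dir ∧ (b.src b.dir - emb e.src b.dir).val < (F.P K).L then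
              ∏ ν ∈ Finset.univ.erase b.dir, max 0 (1 - ((rel (emb e.src) b.src ν).natAbs : ℝ) / (F.P K).L) else 0) →
          (∀ j X b, lift j X b = expPoint (∑ e, wt j b e • ((((F.P K).L : ℕ) : ℝ)⁻¹ • logVec (su2Quat (X e))))) →
          (∀ j, j < K - J → ∀ x, g j x =
            (axialT (lift j (GaugeField.gaugeAct (g (j + 1)) (Averaging.iter (fun k => blockAvg (P := F.P K) (j := k) ℰp) (j + 1) (fun ℓ => expPoint (ζ ℓ) * U₀ ℓ))))
                (emb (blockOf x)) x)⁻¹ *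
              g (j + 1) (blockOf x) * axialT (Averaging.iter (fun k => blockAvg (P := F.P K) (j := k) ℰp) j (fun ℓ => expPoint (ζ ℓ) * U₀ ℓ)) (emb (blockOf x)) x) →
          (∀ j, K - J ≤ j → ∀ y, g j y = 1) →
          (∀ j, j < K - J → ∀ y : Site (F.P K) (j + 1), g j (emb y) = g (j + 1) y) →
          (∀ X : GaugeField (F.P K) 0 SU2, ∀ j, j ≤ K - J →
            Averaging.iter (fun k => blockAvg (P := F.P K) (j := k) ℰp) j (GaugeField.gaugeAct (g 0) X) =
              GaugeField.gaugeAct (g j) (Averaging.iter (fun k => blockAvg (P := F.P K) (j := k) ℰp) j X)) →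
          (∀ j, j < K - J → ∀ x,
            axialT (GaugeField.gaugeAct (g j) (Averaging.iter (fun k => blockAvg (P := F.P K) (j := k) ℰp) j (fun ℓ => expPoint (ζ ℓ) * U₀ ℓ))) (emb (blockOf x)) x =
              axialT (lift j (GaugeField.gaugeAct (g (j + 1)) (Averaging.iter (fun k => blockAvg (P := F.P K) (j := k) ℰp) (j + 1) (fun ℓ => expPoint (ζ ℓ) * U₀ ℓ))))
                (emb (blockOf x)) x) →
          (∀ j, j < K - J →
            (blockAvg (P := F.P K) (j := j) ℰp).avg (GaugeField.gaugeAct (g j) (Averaging.iter (fun k => blockAvg (P := F.P K) (j := k) ℰp) j (fun ℓ => expPoint (ζ ℓ) * U₀ ℓ))) =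
              GaugeField.gaugeAct (g (j + 1)) (Averaging.iter (fun k => blockAvg (P := F.P K) (j := k) ℰp) (j + 1) (fun ℓ => expPoint (ζ ℓ) * U₀ ℓ))) →
          (∀ j, j < K - J → ∀ x, g₀ j x =
            (axialT (lift j (GaugeField.gaugeAct (g₀ (j + 1)) (Averaging.iter (fun k => blockAvg (P := F.P K) (j := k) ℰp) (j + 1) U₁)))
                (emb (blockOf x)) x)⁻¹ *
              g₀ (j + 1) (blockOf x) * axialT (Averaging.iter (fun k => blockAvg (P := F.P K) (j := k) ℰp) j U₁) (emb (blockOf x)) x) →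
          (∀ j, K - J ≤ j → ∀ y, g₀ j y = 1) →
          (∀ j, j < K - J → ∀ y : Site (F.P K) (j + 1), g₀ j (emb y) = g₀ (j + 1) y) →
          (∀ X : GaugeField (F.P K) 0 SU2, ∀ j, j ≤ K - J →
            Averaging.iter (fun k => blockAvg (P := F.P K) (j := k) ℰp) j (GaugeField.gaugeAct (g₀ 0) X) =
              GaugeField.gaugeAct (g₀ j) (Averaging.iter (fun k => blockAvg (P := F.P K) (j := k) ℰp) j X)) →
          (∀ j, j < K - J → ∀ x,
            axialT (GaugeField.gaugeAct (g₀ j) (Averaging.iter (fun k => blockAvg (P := F.P K) (j := k) ℰp) j U₁)) (emb (blockOf x)) x =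
              axialT (lift j (GaugeField.gaugeAct (g₀ (j + 1)) (Averaging.iter (fun k => blockAvg (P := F.P K) (j := k) ℰp) (j + 1) U₁)))
                (emb (blockOf x)) x) →
          (∀ j, j < K - J →
            (blockAvg (P := F.P K) (j := j) ℰp).avg (GaugeField.gaugeAct (g₀ j) (Averaging.iter (fun k => blockAvg (P := F.P K) (j := k) ℰp) j U₁)) =
              GaugeField.gaugeAct (g₀ (j + 1)) (Averaging.iter (fun k => blockAvg (P := F.P K) (j := k) ℰp) (j + 1) U₁)) →
          (∀ X : GaugeField (F.P K) 0 SU2, Averaging.iter (fun k => blockAvg (P := F.P K) (j := k) ℰp) (K - J) (GaugeField.gaugeAct (fun x => (g 0 x)⁻¹) X) = Averaging.iter (fun k => blockAvg (P := F.P K) (j := k) ℰp) (K - J) X) →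
          (∀ X : GaugeField (F.P K) 0 SU2, Averaging.iter (fun k => blockAvg (P := F.P K) (j := k) ℰp) (K - J) (GaugeField.gaugeAct (g₀ 0) X) = Averaging.iter (fun k => blockAvg (P := F.P K) (j := k) ℰp) (K - J) X) →
          U₀ = GaugeField.gaugeAct (fun x => (g 0 x)⁻¹ * g₀ 0 x) U₁ →

                      ∃ X : ℕ → ℝ,
            (∀ (t : ℕ) (ht : t < K - J), (fun (u : ℕ) (hu : u < K - J) => ∑ B : PBond (F.P J) 0,
            ‖(fun ℓ' : PBond (F.P (J + (u + 1))) 0 =>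
              if (∃ z : Site (F.P (J + (u + 1))) 0,
                (B14.Eq22Determines.blockIter (u + 1) z = (bondShift (F.sitesPerDir_eq (m := F.m) (K := J) (j := 0) (m' := F.m) (K' := J + (u + 1)) (j' := u + 1) (by omega)) B).src ∨ B14.Eq22Determines.blockIter (u + 1) z = (bondShift (F.sitesPerDir_eq (m := F.m) (K := J) (j := 0) (m' := F.m) (K' := J + (u + 1)) (j' := u + 1) (by omega)) B).tgt) ∧
                ∀ ν, (B10Eq27TorusAxialLog.rel z ℓ'.src ν).natAbs ≤ 2) ∧
                ¬ (blockOf (ℓ'.src.shift ℓ'.dir) = blockOf ℓ'.src ∧ ∀ ν, ν < ℓ'.dir → B10Eq27TorusAxialLog.rel (emb (blockOf ℓ'.src)) ℓ'.src ν = 0)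
              then logVec (su2Quat ((lift (K - (J + (u + 1))) (GaugeField.gaugeAct (g ((K - (J + (u + 1))) + 1)) (Averaging.iter (fun k => blockAvg (P := F.P K) (j := k) ℰp) ((K - (J + (u + 1))) + 1) (fun ℓ => expPoint (ζ ℓ) * U₀ ℓ))) (bondShift (F.sitesPerDir_eq (m := F.m) (K := J + (u + 1)) (j := 0) (m' := F.m) (K' := K) (j' := (K - (J + (u + 1)))) (by omega)) ℓ') *
                    (lift (K - (J + (u + 1))) (GaugeField.gaugeAct (g₀ ((K - (J + (u + 1))) + 1)) (Averaging.iter (fun k => blockAvg (P := F.P K) (j := k) ℰp) ((K - (J + (u + 1))) + 1) U₁)) (bondShift (F.sitesPerDir_eq (m := F.m) (K := J + (u + 1)) (j := 0) (m' := F.m) (K' := K) (j' := (K - (J + (u + 1)))) (by omega)) ℓ'))⁻¹)⁻¹ *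
                  (GaugeField.gaugeAct (g (K - (J + (u + 1)))) (Averaging.iter (fun k => blockAvg (P := F.P K) (j := k) ℰp) (K - (J + (u + 1))) (fun ℓ => expPoint (ζ ℓ) * U₀ ℓ)) (bondShift (F.sitesPerDir_eq (m := F.m) (K := J + (u + 1)) (j := 0) (m' := F.m) (K' := K) (j' := (K - (J + (u + 1)))) (by omega)) ℓ') *
                    (GaugeField.gaugeAct (g₀ (K - (J + (u + 1)))) (Averaging.iter (fun k => blockAvg (P := F.P K) (j := k) ℰp) (K - (J + (u + 1))) U₁) (bondShift (F.sitesPerDir_eq (m := F.m) (K := J + (u + 1)) (j := 0) (m' := F.m) (K' := K) (j' := (K - (J + (u + 1)))) (by omega)) ℓ'))⁻¹))) else 0)‖ ^ 2) t ht ≤ X t + q * (fun (t : ℕ) (ht : t < K - J) => ∑ B : PBond (F.P J) 0,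
            ‖(fun ℓ' : PBond (F.P (J + (t + 1))) 0 =>
              if ∃ z : Site (F.P (J + (t + 1))) 0,
                (B14.Eq22Determines.blockIter (t + 1) z = (bondShift (F.sitesPerDir_eq (m := F.m) (K := J) (j := 0) (m' := F.m) (K' := J + (t + 1)) (j' := t + 1) (by omega)) B).src ∨ B14.Eq22Determines.blockIter (t + 1) z = (bondShift (F.sitesPerDir_eq (m := F.m) (K := J) (j := 0) (m' := F.m) (K' := J + (t + 1)) (j' := t + 1) (by omega)) B).tgt) ∧
                ∀ ν, (B10Eq27TorusAxialLog.rel z ℓ'.src ν).natAbs ≤ 2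
              then logVec (su2Quat (descendTo F ℰp (J + (t + 1)) K (by omega) (fun ℓ => expPoint (ζ ℓ) * U₀ ℓ : GaugeField (F.P K) 0 (Matrix.specialUnitaryGroup (Fin 2) ℂ)) ℓ' * (descendTo F ℰp (J + (t + 1)) K (by omega) U₀ ℓ')⁻¹)) else 0)‖ ^ 2) t ht) ∧
            ∑ t ∈ Finset.range (K - J), (F.L : ℝ) ^ t * X t ≤ C_X * Real.exp (c_X * ∑ i ∈ Finset.range (K - J), (((5 * F.L : ℕ) : ℝ) ^ 2 / 4) * θ (K - i)) * (((F.L : ℝ)⁻¹) ^ (K - J) * ∑ ℓ : PBond (F.P K) 0, ‖ζ ℓ‖ ^ 2 +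
                (F.L : ℝ) ^ (K - J) * ∑ p : Plaq (F.P K) 0,
                  (1 - reTr ((GaugeField.plaqHol U₀ p)⁻¹ * GaugeField.plaqHol (fun ℓ => expPoint (ζ ℓ) * U₀ ℓ : GaugeField (F.P K) 0 (Matrix.specialUnitaryGroup (Fin 2) ℂ)) p))) +
              β_X * (∑ t ∈ Finset.range (K - J), (if ht : t < K - J then
          (F.L : ℝ) ^ t * ∑ B : PBond (F.P J) 0,
            ‖(fun ℓ' : PBond (F.P (J + (t + 1))) 0 =>
              if ∃ z : Site (F.P (J + (t + 1))) 0,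
                (B14.Eq22Determines.blockIter (t + 1) z = (bondShift (F.sitesPerDir_eq (m := F.m) (K := J) (j := 0) (m' := F.m) (K' := J + (t + 1)) (j' := t + 1) (by omega)) B).src ∨ B14.Eq22Determines.blockIter (t + 1) z = (bondShift (F.sitesPerDir_eq (m := F.m) (K := J) (j := 0) (m' := F.m) (K' := J + (t + 1)) (j' := t + 1) (by omega)) B).tgt) ∧
                ∀ ν, (B10Eq27TorusAxialLog.rel z ℓ'.src ν).natAbs ≤ 2
              then logVec (su2Quat (descendTo F ℰp (J + (t + 1)) K (by omega) (fun ℓ => expPoint (ζ ℓ) * U₀ ℓ : GaugeField (F.P K) 0 (Matrix.specialUnitaryGroup (Fin 2) ℂ)) ℓ' * (descendTo F ℰp (J + (t + 1)) K (by omega) U₀ ℓ')⁻¹)) else 0)‖ ^ 2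
        else 0))) :

    ∀ (L : ℕ), ∃ c₀ : ℝ, 0 < c₀ ∧ c₀ ≤ 1 ∧ ∀ (cw : ℝ), 0 < cw → cw ≤ c₀ → ∃ pS : ℝ, ∀ (b₀ p₀ : ℝ), 0 < b₀ → pS ≤ p₀ → 0 < p₀ → ∃ ε₁ : ℝ, 0 < ε₁ ∧ ∀ (ε₀ : ℝ), 0 < ε₀ → ε₀ ≤ ε₁ →
    ∃ γ₁ : ℝ, 0 < γ₁ ∧ ∃ μ : ℝ, 0 < μ ∧ ∀ (F : T3Family) (γ : ℝ), F.L = L → 0 < γ → γ ≤ γ₁ → ∃ J₀ : ℕ,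
      ∀ (J K : ℕ) (hJ₀ : J₀ ≤ J) (hJK : J ≤ K) (V : GaugeField (F.P J) 0 (Matrix.specialUnitaryGroup (Fin 2) ℂ)), PlaqSmall (θBal F.L γ (cw * b₀) p₀ J) V →
        ∀ U₀ ∈ {U' : GaugeField (F.P K) 0 (Matrix.specialUnitaryGroup (Fin 2) ℂ) | U' ∈ fibre F ℰp J K hJK V ∧ U' ∈ histGood F ℰp (θBal F.L γ b₀ p₀) K J ∧
            wilsonAction4 U' = minActionRegPr F J K hJK ε₀ V},
        ∀ U ∈ fibre F ℰp J K hJK V, U ∈ histGood F ℰp (θBal F.L γ b₀ p₀) K J →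
          μ * ((F.L : ℝ)⁻¹) ^ (2 * (K - J)) *
              (⨅ w : {w : GaugeTransf (F.P K) 0 (Matrix.specialUnitaryGroup (Fin 2) ℂ) | ∀ U : GaugeField (F.P K) 0 (Matrix.specialUnitaryGroup (Fin 2) ℂ),
                  descendTo F ℰp J K hJK (GaugeField.gaugeAct w U) = descendTo F ℰp J K hJK U}, ∑ ℓ : PBond (F.P K) 0,
                dist1 (U ℓ * ((GaugeField.gaugeAct (w : GaugeTransf (F.P K) 0 (Matrix.specialUnitaryGroup (Fin 2) ℂ)) U₀) ℓ)⁻¹) ^ 2)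
            ≤ wilsonAction4 U - minActionRegPr F J K hJK ε₀ V :=
  uniformFibreGapOrbit_of_strata_floor
    (gapStratum_of_guardedLetters_floor
      (fun F J V =>
      (∀ c : Site (F.P J) 0 → Matrix (Fin 2) (Fin 2) ℂ,
          (∀ e : PBond (F.P J) 0, c e.src = ((unitsField (toUField V) e : (Matrix (Fin 2) (Fin 2) ℂ)ˣ) : Matrix (Fin 2) (Fin 2) ℂ) * c e.tgt *
            (((unitsField (toUField V) e)⁻¹ : (Matrix (Fin 2) (Fin 2) ℂ)ˣ) : Matrix (Fin 2) (Fin 2) ℂ)) →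
          ∃ z : ℂ, ∀ y, c y = z • (1 : Matrix (Fin 2) (Fin 2) ℂ)))
      G₁' s₀ hs₀ hGs₁ h3 hsupp₁ hD₁ hDBX₁)
    (gapStratum_of_guardedLetters_floor
      (fun F J V =>
      (∃ g : GaugeTransf (F.P J) 0 (Matrix.specialUnitaryGroup (Fin 2) ℂ),
          (∀ e : PBond (F.P J) 0, Commute (((GaugeField.gaugeAct g V) e : Matrix.specialUnitaryGroup (Fin 2) ℂ) : Matrix (Fin 2) (Fin 2) ℂ) σ₃) ∧
          ∀ c : Site (F.P J) 0 → Matrix (Fin 2) (Fin 2) ℂ,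
            (∀ e : PBond (F.P J) 0, c e.src = ((unitsField (toUField (GaugeField.gaugeAct g V)) e : (Matrix (Fin 2) (Fin 2) ℂ)ˣ) : Matrix (Fin 2) (Fin 2) ℂ) * c e.tgt *
            (((unitsField (toUField (GaugeField.gaugeAct g V)) e)⁻¹ : (Matrix (Fin 2) (Fin 2) ℂ)ˣ) : Matrix (Fin 2) (Fin 2) ℂ)) →
            ∃ c₀ : Matrix (Fin 2) (Fin 2) ℂ, (∀ y, c y = c₀) ∧ Commute c₀ σ₃))
      G₂' s₀ hs₀ hGs₂ h3 hsupp₂ hD₂ hDBX₂)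

end Summit.QuantumFields.YangMills.Theorems.FluctuationComparisonRegPrIntLS2BetaGapOrbitOfGuardedStrataFloor

end
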